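import Literature.NumberTheory.Rogawski1990.ArchPlaneHaarHSBallLocal     -- ★ «(T2-out)» `haar_unitaryGroupOfForm_antidiag_two_hsBall_le_linear` (LH3-p02 ∕ LH3-p04)
import Literature.NumberTheory.Rogawski1990.ArchHSBallVolumeProduct      -- ★ `locallyCompactSpace_mixedSpaceGL`, `secondCountableTopology_mixedSpaceGL` (+ ★ `archPiEquivCM`, `coe_archPiEquivCM_apply`)
import Literature.NumberTheory.Automorphic.UnitaryGroupFormTransport     -- ★ `formCongr`, `unitaryGroupOfFormCongrOfEq` (`y ↦ T y T⁻¹`)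
import Literature.NumberTheory.Automorphic.AdelicHeightGLProofs          -- ★ `nnnorm_apply_le_sup`, `GLn.archHeight`, `GLn.toMixed_ofInfinite`
import Mathlib.MeasureTheory.Measure.Haar.Unique
import HarnessLib

/-!
# Crux `HLiu418`, Track B road `K2_Liu`, organ (B∞) «ARCHIMEDEAN SLICE» of #32dR — brick B3′:
# the Haar volume of the archimedean height ball `{b ∈ U(V)(L ⊗ ℝ) : H_∞(b) ≤ R}` is `O(R²)` for a hermitian PLANE definite at all places but one

Cell `hodgecm-mathlib`, crux item hLiu418 = `stmt-HodgeConjecture-24832`, route of record `HCCMUnconditional`; squad K2 ∕ K2Liu,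
prover K2Liu-p02 (g3); LEAD deal 03:15:05Z (organ (B∞) `K2LiuDoublingHeightArchSlice`, the `_harch` hypothesis of ★ p856795 at `N = 2` with the
sign data `(ι, hpos)` of #32dR).  THEOREMS ONLY; lane `--supports stmt-HodgeConjecture-24832 --as helper`.

THE POINT.  The integrability threshold `τ > 2 = 2N − 2` of the archimedean slice of #32dR is SHARP, so the volume of the height shells must be known
with the sharp exponent: `ν{H_∞ ≤ R} = O(R²)` on `G_∞ = U(diag d)(L ⊗ ℝ)`, `N = 2`.  No Cartan `KA⁺K` and no Haar measure in coordinates is needed: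
the rank-one input already stands in line LH3's (VOL) plumbing — ★ «(T2-out)» `haar_unitaryGroupOfForm_antidiag_two_hsBall_le_linear`: EVERY Haar
measure of `U(Φ₂)(ℂ) ≅ U(1,1)` gives Hilbert–Schmidt balls `{Σ|g_ij|² ≤ ρ}` mass `≤ C ρ` ([BeuzartPlessis2020Asterisque, §1.5 (1.5.2)–(1.5.3)] via the
`S¹ × SL₂(ℝ)` model and `vol{‖g‖²_HS ≤ ρ} ≤ 16π ρ` in `SL₂(ℝ)`).  This file transports it:

* §1 `norm_apply_le_archHeight_ofInfinite` (entries are bounded by `H_∞`), `norm_conj_apply_le` (entries of `T y T⁻¹` are `≤ κ_T · max|y_ij|`);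
* §2 **`haar_entryBox_le_of_formCongr_antidiag`** — for a complex hermitian `J` CONGRUENT to `Φ₂` (`J = Tᴴ Φ₂ T`) every Haar measure `ν` of `U(J)(ℂ)` has
  `ν{y : |y_ij| ≤ r ∀ i j} ≤ C r²` (`r ≥ 1`): ★ `unitaryGroupOfFormCongrOfEq` `y ↦ T y T⁻¹` carries `ν` to a Haar measure of `U(Φ₂)(ℂ)` and entry boxes into
  HS-balls of radius `4κ²r² + 2`;
* §3 `exists_formCongr_antidiag_eq_diagonal` — an INDEFINITE real diagonal plane `diag(a, b)`, `ab < 0`, is congruent to `Φ₂` (`T = [[p, q], [±p, ∓q]]`,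
  `2p² = |a|`, `2q² = |b|`); **`haar_archLocal_entryBox_le`** — at EVERY complex place `w` of the CM field, every Haar measure of
  `U(diag σ_w d)(ℂ)` (`d` real, non-zero) has entry boxes of mass `≤ C r²`: same signs ⇒ `±diag σ_w d` definite ⇒ compact (★ `isCompact_archLocal_of_posDef`),
  opposite signs ⇒ §2;
* §4 **`haar_arch_heightBall_le`** — on `G_∞ = U(diag d)(L ⊗ ℝ)`, `N = 2`, with #32dR's sign data (`diag d` is `τ′`-definite at every complex embedding
  `τ′` off the place of `ι`): for every Haar `ν`, **`ν{b : H_∞(b) ≤ R} ≤ C R²`** (`R ≥ 1`; `H_∞ = GLn.archHeight ∘ GLn.ofInfinite`): ★ `archPiEquivCM`,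
  product Haar and Haar uniqueness (the template of ★ `haar_setOf_prod_place_le_of_marginal_growth`), the height ball lies in the product of the entry
  boxes (sup norm on the mixed space), the places `w ≠ w_ι` are compact of finite mass and `w_ι` is §3.
[cite: BeuzartPlessis2020Asterisque, §1.5 (1.5.2)–(1.5.3) p. 31] [cite: Borel1997, §2.3; §4.1 (1)–(3)] [cite: PlatonovRapinchuk1994, §2.3; §3.2 Thm 3.1]
[cite: BorelJacquet1979, §1.2, §4.1]

HONEST LABEL.  `HC_CM` is proved only modulo the 7 printed citations (2 remaining named inputs: hLiu418 = `stmt-HodgeConjecture-24832`, h413 =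
`stmt-HodgeConjecture-24833`) until rung 0 closes; this file is a brick of organ (B∞) and retires nothing by itself.
-/

set_option autoImplicit false
-- the mandated namespace repeats the single-problem summit's segment (`HodgeConjecture.HodgeConjecture`)
set_option linter.dupNamespace false

noncomputable section

open scoped Matrix NNReal ENNReal MatrixGroups ComplexConjugate ComplexOrder Classical
open MeasureTheory MeasureTheory.Measure Set NumberField NumberField.InfinitePlace NumberField.mixedEmbedding

namespace Summit.HodgeConjecture.HodgeConjecture.Cruxes.HLiu418.K2LiuArchHeightBallRankOne

open Literature.NumberTheory.Automorphic Literature.NumberTheory.Automorphic.UnitaryGroup Literature.NumberTheory.Rogawski1990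

/-! ## §1 Entry bounds -/

section Entries

/-- Entries of `b ∈ GL_N(L ⊗ ℝ)` are bounded by the archimedean height `H_∞(b) = max_{i,j}(‖b_ij‖ ⊔ ‖(b⁻¹)_ij‖)` (★ `nnnorm_apply_le_sup`, ★ `GLn.toMixed_ofInfinite`).
[cite: BorelJacquet1979, §1.2] -/
theorem norm_apply_le_archHeight_ofInfinite {K : Type} [Field K] [NumberField K] {N : ℕ} (b : GL (Fin N) (mixedSpace K)) (i j : Fin N) :
    ‖(b : Matrix (Fin N) (Fin N) (mixedSpace K)) i j‖ ≤ (GLn.archHeight N K (GLn.ofInfinite N K b) : ℝ) := by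
  have h := nnnorm_apply_le_sup b i j
  unfold GLn.archHeight
  rw [GLn.toMixed_ofInfinite]
  exact_mod_cast h

/-- If `|A_ik| ≤ s` and `|B_kj| ≤ t` for all indices (`2 × 2` complex matrices) then `|(A B)_ij| ≤ 2 s t`. [folklore] -/
theorem norm_mul_apply_le_two {A B : Matrix (Fin 2) (Fin 2) ℂ} {s t : ℝ} (hA : ∀ i k, ‖A i k‖ ≤ s) (hB : ∀ k j, ‖B k j‖ ≤ t) (i j : Fin 2) :
    ‖(A * B) i j‖ ≤ 2 * s * t := by
  have hs : 0 ≤ s := (norm_nonneg _).trans (hA 0 0)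
  rw [Matrix.mul_apply, Fin.sum_univ_two]
  refine (norm_add_le _ _).trans ?_
  rw [norm_mul, norm_mul]
  nlinarith [mul_le_mul (hA i 0) (hB 0 j) (norm_nonneg _) hs, mul_le_mul (hA i 1) (hB 1 j) (norm_nonneg _) hs]

/-- Entries of a conjugate: `|(T y T⁻¹)_ij| ≤ 4 (Σ|T_kl|) (Σ|(T⁻¹)_kl|) · max|y_ij|` (crudely). [folklore] -/
theorem norm_conj_apply_le (T : GL (Fin 2) ℂ) {y : Matrix (Fin 2) (Fin 2) ℂ} {r : ℝ} (hy : ∀ i j, ‖y i j‖ ≤ r) (i j : Fin 2) :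
    ‖((T : Matrix (Fin 2) (Fin 2) ℂ) * y * ((T⁻¹ : GL (Fin 2) ℂ) : Matrix (Fin 2) (Fin 2) ℂ)) i j‖ ≤
      4 * (∑ k, ∑ l, ‖(T : Matrix (Fin 2) (Fin 2) ℂ) k l‖) * (∑ k, ∑ l, ‖((T⁻¹ : GL (Fin 2) ℂ) : Matrix (Fin 2) (Fin 2) ℂ) k l‖) * r := by
  have hT : ∀ i k, ‖(T : Matrix (Fin 2) (Fin 2) ℂ) i k‖ ≤ ∑ k, ∑ l, ‖(T : Matrix (Fin 2) (Fin 2) ℂ) k l‖ := fun i k =>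
    (Finset.single_le_sum (f := fun l => ‖(T : Matrix (Fin 2) (Fin 2) ℂ) i l‖) (fun _ _ => norm_nonneg _) (Finset.mem_univ k)).trans
      (Finset.single_le_sum (f := fun k => ∑ l, ‖(T : Matrix (Fin 2) (Fin 2) ℂ) k l‖)
        (fun _ _ => Finset.sum_nonneg fun _ _ => norm_nonneg _) (Finset.mem_univ i))
  have hT' : ∀ i k, ‖((T⁻¹ : GL (Fin 2) ℂ) : Matrix (Fin 2) (Fin 2) ℂ) i k‖ ≤ ∑ k, ∑ l, ‖((T⁻¹ : GL (Fin 2) ℂ) : Matrix (Fin 2) (Fin 2) ℂ) k l‖ :=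
    fun i k =>
    (Finset.single_le_sum (f := fun l => ‖((T⁻¹ : GL (Fin 2) ℂ) : Matrix (Fin 2) (Fin 2) ℂ) i l‖) (fun _ _ => norm_nonneg _) (Finset.mem_univ k)).trans
      (Finset.single_le_sum (f := fun k => ∑ l, ‖((T⁻¹ : GL (Fin 2) ℂ) : Matrix (Fin 2) (Fin 2) ℂ) k l‖)
        (fun _ _ => Finset.sum_nonneg fun _ _ => norm_nonneg _) (Finset.mem_univ i))
  have h1 := norm_mul_apply_le_two hT hy
  have h2 := norm_mul_apply_le_two h1 hT' i j
  refine h2.trans (le_of_eq ?_)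
  ring

end Entries

/-! ## §2 A plane congruent to `Φ₂`: entry boxes of `U(J)(ℂ)` have Haar mass `O(r²)` -/

section Congruent

/-- **ENTRY BOXES IN `U(J)(ℂ)`, `J = Tᴴ Φ₂ T`, HAVE HAAR MASS `O(r²)`.**  For every Haar measure `ν` of `U(J)(ℂ)`: `ν{y : |y_ij| ≤ r ∀ i,j} ≤ C r²` for `r ≥ 1`.
The iso ★ `unitaryGroupOfFormCongrOfEq` (`y ↦ T y T⁻¹`) carries `ν` to a Haar measure of `U(Φ₂)(ℂ)` and the entry box into the Hilbert–Schmidt ball of radius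
`4κ²r² + 2` (§1), whose mass is linear in the radius by ★ «(T2-out)». [cite: BeuzartPlessis2020Asterisque, §1.5 (1.5.2)–(1.5.3) p. 31] [cite: PlatonovRapinchuk1994, §2.3] -/
theorem haar_entryBox_le_of_formCongr_antidiag {J : Matrix (Fin 2) (Fin 2) ℂ} (T : GL (Fin 2) ℂ)
    (hT : formCongr (starRingEnd ℂ) T (Matrix.of fun i j : Fin 2 => if i.val + j.val + 1 = 2 then (1 : ℂ) else 0) = J)
    [MeasurableSpace ↥(unitaryGroupOfForm (starRingEnd ℂ) J)] [BorelSpace ↥(unitaryGroupOfForm (starRingEnd ℂ) J)]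
    (ν : Measure ↥(unitaryGroupOfForm (starRingEnd ℂ) J)) [ν.IsHaarMeasure] :
    ∃ C : ℝ, 0 ≤ C ∧ ∀ r : ℝ, 1 ≤ r →
      ν {y | ∀ i j, ‖((y : GL (Fin 2) ℂ) : Matrix (Fin 2) (Fin 2) ℂ) i j‖ ≤ r} ≤ ENNReal.ofReal (C * r ^ 2) := by
  letI : MeasurableSpace ↥(unitaryGroupOfForm (starRingEnd ℂ) (Matrix.of fun i j : Fin 2 => if i.val + j.val + 1 = 2 then (1 : ℂ) else 0)) := borel _
  haveI : BorelSpace ↥(unitaryGroupOfForm (starRingEnd ℂ) (Matrix.of fun i j : Fin 2 => if i.val + j.val + 1 = 2 then (1 : ℂ) else 0)) := ⟨rfl⟩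
  set θ := unitaryGroupOfFormCongrOfEq (starRingEnd ℂ) T (Matrix.of fun i j : Fin 2 => if i.val + j.val + 1 = 2 then (1 : ℂ) else 0) J hT with hθ
  set μ : Measure ↥(unitaryGroupOfForm (starRingEnd ℂ) (Matrix.of fun i j : Fin 2 => if i.val + j.val + 1 = 2 then (1 : ℂ) else 0)) :=
    Measure.map θ ν with hμ
  haveI : μ.IsHaarMeasure := by rw [hμ]; infer_instance
  obtain ⟨C₀, hC₀⟩ := haar_unitaryGroupOfForm_antidiag_two_hsBall_le_linear μ
  -- the distortion constant of `y ↦ T y T⁻¹` on entries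
  set κ : ℝ := 4 * (∑ k, ∑ l, ‖(T : Matrix (Fin 2) (Fin 2) ℂ) k l‖) * (∑ k, ∑ l, ‖((T⁻¹ : GL (Fin 2) ℂ) : Matrix (Fin 2) (Fin 2) ℂ) k l‖) with hκ
  have hκ0 : 0 ≤ κ := mul_nonneg (mul_nonneg (by norm_num) (Finset.sum_nonneg fun _ _ => Finset.sum_nonneg fun _ _ => norm_nonneg _))
    (Finset.sum_nonneg fun _ _ => Finset.sum_nonneg fun _ _ => norm_nonneg _)
  refine ⟨max C₀ 0 * (4 * κ ^ 2 + 2), mul_nonneg (le_max_right _ _) (by positivity), fun r hr => ?_⟩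
  have hr0 : 0 ≤ r := zero_le_one.trans hr
  -- the entry box lies in the preimage of the HS-ball of radius `4κ²r² + 2`
  have hsub : {y : ↥(unitaryGroupOfForm (starRingEnd ℂ) J) | ∀ i j, ‖((y : GL (Fin 2) ℂ) : Matrix (Fin 2) (Fin 2) ℂ) i j‖ ≤ r} ⊆
      θ ⁻¹' {z | ∑ i : Fin 2, ∑ j : Fin 2, ‖((z : GL (Fin 2) ℂ) : Matrix (Fin 2) (Fin 2) ℂ) i j‖ ^ 2 ≤ 4 * κ ^ 2 * r ^ 2 + 2} := by
    intro y hy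
    rw [Set.mem_preimage, Set.mem_setOf_eq]
    have he : ∀ i j, ‖(((θ y : ↥(unitaryGroupOfForm (starRingEnd ℂ) _)) : GL (Fin 2) ℂ) : Matrix (Fin 2) (Fin 2) ℂ) i j‖ ≤ κ * r := fun i j => by
      rw [hθ, coe_unitaryGroupOfFormCongrOfEq_apply, Units.val_mul, Units.val_mul]
      exact norm_conj_apply_le T hy i j
    have hsq : ∀ i j, ‖(((θ y : ↥(unitaryGroupOfForm (starRingEnd ℂ) _)) : GL (Fin 2) ℂ) : Matrix (Fin 2) (Fin 2) ℂ) i j‖ ^ 2 ≤ (κ * r) ^ 2 :=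
      fun i j => pow_le_pow_left₀ (norm_nonneg _) (he i j) 2
    calc ∑ i : Fin 2, ∑ j : Fin 2, ‖(((θ y : ↥(unitaryGroupOfForm (starRingEnd ℂ) _)) : GL (Fin 2) ℂ) : Matrix (Fin 2) (Fin 2) ℂ) i j‖ ^ 2
        ≤ ∑ _i : Fin 2, ∑ _j : Fin 2, (κ * r) ^ 2 := Finset.sum_le_sum fun i _ => Finset.sum_le_sum fun j _ => hsq i j
      _ = 4 * κ ^ 2 * r ^ 2 := by simp only [Finset.sum_const, Finset.card_univ, Fintype.card_fin, nsmul_eq_mul]; push_cast; ring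
      _ ≤ 4 * κ ^ 2 * r ^ 2 + 2 := by linarith
  have hρ : (2 : ℝ) ≤ 4 * κ ^ 2 * r ^ 2 + 2 := by nlinarith [sq_nonneg (κ * r)]
  calc ν {y | ∀ i j, ‖((y : GL (Fin 2) ℂ) : Matrix (Fin 2) (Fin 2) ℂ) i j‖ ≤ r}
      ≤ ν (θ ⁻¹' {z | ∑ i : Fin 2, ∑ j : Fin 2, ‖((z : GL (Fin 2) ℂ) : Matrix (Fin 2) (Fin 2) ℂ) i j‖ ^ 2 ≤ 4 * κ ^ 2 * r ^ 2 + 2}) :=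
        measure_mono hsub
    _ ≤ μ {z | ∑ i : Fin 2, ∑ j : Fin 2, ‖((z : GL (Fin 2) ℂ) : Matrix (Fin 2) (Fin 2) ℂ) i j‖ ^ 2 ≤ 4 * κ ^ 2 * r ^ 2 + 2} := by
        rw [hμ]; exact le_map_apply θ.continuous.measurable.aemeasurable _
    _ ≤ ENNReal.ofReal (C₀ * (4 * κ ^ 2 * r ^ 2 + 2)) := hC₀ _ hρ
    _ ≤ ENNReal.ofReal (max C₀ 0 * (4 * κ ^ 2 + 2) * r ^ 2) := by
        refine ENNReal.ofReal_le_ofReal ?_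
        have h1 : (1 : ℝ) ≤ r ^ 2 := by nlinarith
        calc C₀ * (4 * κ ^ 2 * r ^ 2 + 2) ≤ max C₀ 0 * (4 * κ ^ 2 * r ^ 2 + 2) :=
              mul_le_mul_of_nonneg_right (le_max_left _ _) (by positivity)
          _ ≤ max C₀ 0 * (4 * κ ^ 2 * r ^ 2 + 2 * r ^ 2) := by
              refine mul_le_mul_of_nonneg_left ?_ (le_max_right _ _); nlinarith
          _ = max C₀ 0 * (4 * κ ^ 2 + 2) * r ^ 2 := by ring

end Congruent

/-! ## §3 A real diagonal plane at a complex place: compact or congruent to `Φ₂` -/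

section Diagonal

/-- **An indefinite real diagonal plane is congruent to `Φ₂` over `ℂ`**: for real `a, b` with `ab < 0` there is `T ∈ GL₂(ℂ)` with `Tᴴ Φ₂ T = diag(a, b)`
(`T = [[p, q], [p, −q]]` if `a > 0 > b`, `T = [[p, q], [−p, q]]` if `a < 0 < b`, `2p² = |a|`, `2q² = |b|`). [cite: PlatonovRapinchuk1994, §2.3] -/
theorem exists_formCongr_antidiag_eq_diagonal (a b : ℝ) (hab : a * b < 0) :
    ∃ T : GL (Fin 2) ℂ, formCongr (starRingEnd ℂ) T (Matrix.of fun i j : Fin 2 => if i.val + j.val + 1 = 2 then (1 : ℂ) else 0) =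
      Matrix.diagonal ![(a : ℂ), (b : ℂ)] := by
  rcases mul_neg_iff.1 hab with ⟨ha, hb⟩ | ⟨ha, hb⟩
  · -- `a > 0 > b`: `T = [[p, q], [p, −q]]`
    set p : ℝ := Real.sqrt (a / 2) with hp
    set q : ℝ := Real.sqrt (-b / 2) with hq
    have hp0 : 0 < p := Real.sqrt_pos.2 (by linarith)
    have hq0 : 0 < q := Real.sqrt_pos.2 (by linarith)
    have hpC : (p : ℂ) * (p : ℂ) = (a : ℂ) / 2 := by
      rw [← Complex.ofReal_mul, Real.mul_self_sqrt (by linarith : 0 ≤ a / 2)]; push_cast; ring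
    have hqC : (q : ℂ) * (q : ℂ) = -(b : ℂ) / 2 := by
      rw [← Complex.ofReal_mul, Real.mul_self_sqrt (by linarith : 0 ≤ -b / 2)]; push_cast; ring
    have hdet : (!![(p : ℂ), (q : ℂ); (p : ℂ), -(q : ℂ)]).det ≠ 0 := by
      rw [Matrix.det_fin_two_of]
      have : (p : ℂ) * -(q : ℂ) - (q : ℂ) * (p : ℂ) = ((-(2 * p * q) : ℝ) : ℂ) := by push_cast; ring
      rw [this, Ne, Complex.ofReal_eq_zero]
      nlinarith [mul_pos hp0 hq0]
    refine ⟨Matrix.GeneralLinearGroup.mkOfDetNeZero _ hdet, ?_⟩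
    ext i j
    fin_cases i <;> fin_cases j <;>
      simp [formCongr, Matrix.GeneralLinearGroup.mkOfDetNeZero, Matrix.mul_apply, Fin.sum_univ_two, Matrix.diagonal, Complex.conj_ofReal]
    · linear_combination (2 : ℂ) * hpC
    · linear_combination (-2 : ℂ) * hqC
  · -- `a < 0 < b`: `T = [[p, q], [−p, q]]`
    set p : ℝ := Real.sqrt (-a / 2) with hp
    set q : ℝ := Real.sqrt (b / 2) with hq
    have hp0 : 0 < p := Real.sqrt_pos.2 (by linarith)
    have hq0 : 0 < q := Real.sqrt_pos.2 (by linarith)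
    have hpC : (p : ℂ) * (p : ℂ) = -(a : ℂ) / 2 := by
      rw [← Complex.ofReal_mul, Real.mul_self_sqrt (by linarith : 0 ≤ -a / 2)]; push_cast; ring
    have hqC : (q : ℂ) * (q : ℂ) = (b : ℂ) / 2 := by
      rw [← Complex.ofReal_mul, Real.mul_self_sqrt (by linarith : 0 ≤ b / 2)]; push_cast; ring
    have hdet : (!![(p : ℂ), (q : ℂ); -(p : ℂ), (q : ℂ)]).det ≠ 0 := by
      rw [Matrix.det_fin_two_of]
      have : (p : ℂ) * (q : ℂ) - (q : ℂ) * -(p : ℂ) = (((2 * p * q) : ℝ) : ℂ) := by push_cast; ring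
      rw [this, Ne, Complex.ofReal_eq_zero]
      nlinarith [mul_pos hp0 hq0]
    refine ⟨Matrix.GeneralLinearGroup.mkOfDetNeZero _ hdet, ?_⟩
    ext i j
    fin_cases i <;> fin_cases j <;>
      simp [formCongr, Matrix.GeneralLinearGroup.mkOfDetNeZero, Matrix.mul_apply, Fin.sum_univ_two, Matrix.diagonal, Complex.conj_ofReal]
    · linear_combination (-2 : ℂ) * hpC
    · linear_combination (2 : ℂ) * hqC

variable (L : Type) [Field L] [NumberField L] [IsCMField L]

/-- **AT A COMPLEX PLACE, ENTRY BOXES OF `U(diag σ_w d)(ℂ)` HAVE HAAR MASS `O(r²)`** (`d` real = `c`-fixed, non-zero, `N = 2`).  The entries `σ_w(dᵢ)` are real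
(★ `embedding_cmConjRingHom`); SAME signs ⇒ `±diag σ_w d` is positive definite ⇒ `U` is compact (★ `isCompact_archLocal_of_posDef`) and every Haar measure is
finite; OPPOSITE signs ⇒ `diag σ_w d` is congruent to `Φ₂` (`exists_formCongr_antidiag_eq_diagonal`) ⇒ §2.
[cite: PlatonovRapinchuk1994, §2.3; §3.2 Thm 3.1] [cite: BeuzartPlessis2020Asterisque, §1.5 (1.5.2)–(1.5.3) p. 31] -/
theorem haar_archLocal_entryBox_le (dV : Fin 2 → L) (hdV : ∀ i, IsCMField.complexConj L (dV i) = dV i) (hdV0 : ∀ i, dV i ≠ 0)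
    (w : {w : InfinitePlace L // w.IsComplex})
    [mJ : MeasurableSpace ↥(archLocal L 2 (Matrix.diagonal dV) w)] [bJ : BorelSpace ↥(archLocal L 2 (Matrix.diagonal dV) w)]
    (ν : Measure ↥(archLocal L 2 (Matrix.diagonal dV) w)) [hν : ν.IsHaarMeasure] :
    ∃ C : ℝ, 0 ≤ C ∧ ∀ r : ℝ, 1 ≤ r →
      ν {y | ∀ i j, ‖((y : GL (Fin 2) ℂ) : Matrix (Fin 2) (Fin 2) ℂ) i j‖ ≤ r} ≤ ENNReal.ofReal (C * r ^ 2) := by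
  -- `σ_w(dᵢ)` is real and non-zero
  have hreal : ∀ i, (((w.1.embedding (dV i)).re : ℝ) : ℂ) = w.1.embedding (dV i) := fun i => by
    refine Complex.conj_eq_iff_re.1 ?_
    rw [← embedding_cmConjRingHom, cmConjRingHom_apply, hdV]
  have hne : ∀ i, (w.1.embedding (dV i)).re ≠ 0 := fun i h0 => by
    have h1 : w.1.embedding (dV i) = 0 := by rw [← hreal i, h0, Complex.ofReal_zero]
    exact hdV0 i ((map_eq_zero _).1 h1)
  have hJ : (Matrix.diagonal dV).map w.1.embedding = Matrix.diagonal ![(((w.1.embedding (dV 0)).re : ℝ) : ℂ), (((w.1.embedding (dV 1)).re : ℝ) : ℂ)] := by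
    rw [Matrix.diagonal_map (map_zero _)]
    congr 1
    funext i
    fin_cases i
    · exact (hreal 0).symm
    · exact (hreal 1).symm
  rcases lt_or_gt_of_ne (mul_ne_zero (hne 0) (hne 1)) with hneg | hpos
  · -- indefinite: congruent to `Φ₂`, §2
    obtain ⟨T, hT⟩ := exists_formCongr_antidiag_eq_diagonal _ _ hneg
    rw [← hJ] at hT
    -- (`archLocal L 2 (diag d) w` unfolds to `unitaryGroupOfForm conj ((diag d).map σ_w)`; the instances are passed by name)
    exact @haar_entryBox_le_of_formCongr_antidiag _ T hT mJ bJ ν hν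
  · -- definite: compact, finite mass
    have hdef : ((Matrix.diagonal dV).map w.1.embedding).PosDef ∨ (-(Matrix.diagonal dV).map w.1.embedding).PosDef := by
      rw [hJ]
      rcases pos_and_pos_or_neg_and_neg_of_mul_pos hpos with ⟨ha, hb⟩ | ⟨ha, hb⟩
      · left
        refine Matrix.posDef_diagonal_iff.2 fun i => ?_
        fin_cases i
        · simpa using ha
        · simpa using hb
      · right
        have hn : -Matrix.diagonal ![(((w.1.embedding (dV 0)).re : ℝ) : ℂ), (((w.1.embedding (dV 1)).re : ℝ) : ℂ)] =
            Matrix.diagonal ![(((-(w.1.embedding (dV 0)).re : ℝ)) : ℂ), (((-(w.1.embedding (dV 1)).re : ℝ)) : ℂ)] := by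
          rw [Matrix.diagonal_neg]
          congr 1
          funext i
          fin_cases i <;> simp
        rw [hn]
        have ha' : (0 : ℂ) < ((-(w.1.embedding (dV 0)).re : ℝ) : ℂ) := Complex.zero_lt_real.2 (by linarith)
        have hb' : (0 : ℂ) < ((-(w.1.embedding (dV 1)).re : ℝ) : ℂ) := Complex.zero_lt_real.2 (by linarith)
        refine Matrix.posDef_diagonal_iff.2 fun i => ?_
        fin_cases i
        · simpa using ha'
        · simpa using hb'
    haveI : CompactSpace ↥(archLocal L 2 (Matrix.diagonal dV) w) :=
      isCompact_iff_compactSpace.1 (isCompact_archLocal_of_posDef L 2 (Matrix.diagonal dV) w hdef)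
    refine ⟨(ν Set.univ).toReal, ENNReal.toReal_nonneg, fun r hr => ?_⟩
    calc ν {y | ∀ i j, ‖((y : GL (Fin 2) ℂ) : Matrix (Fin 2) (Fin 2) ℂ) i j‖ ≤ r} ≤ ν Set.univ := measure_mono (Set.subset_univ _)
      _ = ENNReal.ofReal ((ν Set.univ).toReal) := (ENNReal.ofReal_toReal (measure_ne_top ν _)).symm
      _ ≤ ENNReal.ofReal ((ν Set.univ).toReal * r ^ 2) :=
          ENNReal.ofReal_le_ofReal (le_mul_of_one_le_right ENNReal.toReal_nonneg (one_le_pow₀ hr))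

end Diagonal

/-! ## §4 The archimedean height ball in `U(diag d)(L ⊗ ℝ)`, `N = 2`, has Haar mass `O(R²)` -/

section Arch

variable (L : Type) [Field L] [NumberField L] [IsCMField L]

/-- **THE HAAR VOLUME OF THE ARCHIMEDEAN HEIGHT BALL IS `O(R²)`** (brick B3′ of organ (B∞)).  `N = 2`, `d` real non-zero, and #32dR's sign data: `diag d` is
`τ′`-positive-definite at every complex embedding `τ′` off the place of `ι`.  Then for EVERY Haar measure `ν` on `G_∞ = U(diag d)(L ⊗ ℝ)` there is `C ≥ 0`
with **`ν{b : H_∞(b) ≤ R} ≤ C R²`** for all `R ≥ 1` (`H_∞ = GLn.archHeight ∘ GLn.ofInfinite`, the archimedean height of ★ `AdelicGLnGlue`).  Transport along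
★ `archPiEquivCM : G_∞ ≃ₜ* Π_w U(diag σ_w d)(ℂ)`, product Haar and Haar uniqueness (`isMulLeftInvariant_eq_smul`); the height ball lies in the product of the
entry boxes (sup norm on `L ⊗ ℝ`, ★ `coe_archPiEquivCM_apply`); the places `w ≠ w_ι` are compact (finite mass) and `w_ι` is §3 — ONE factor `R²`.
[cite: BeuzartPlessis2020Asterisque, §1.5 (1.5.2)–(1.5.3) p. 31] [cite: BorelJacquet1979, §1.2, §4.1] [cite: PlatonovRapinchuk1994, §3.2 Thm 3.1] -/
theorem haar_arch_heightBall_le (dV : Fin 2 → L) (hdV : ∀ i, IsCMField.complexConj L (dV i) = dV i) (hdV0 : ∀ i, dV i ≠ 0) (ι : L →+* ℂ)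
    (hpos : ∀ τ' : L →+* ℂ, InfinitePlace.mk τ' ≠ InfinitePlace.mk ι → ((Matrix.diagonal dV).map τ').PosDef)
    [MeasurableSpace ↥(arch (↥(maximalRealSubfield L)) L (IsCMField.complexConj L) 2 (Matrix.diagonal dV))]
    [BorelSpace ↥(arch (↥(maximalRealSubfield L)) L (IsCMField.complexConj L) 2 (Matrix.diagonal dV))]
    (ν : Measure ↥(arch (↥(maximalRealSubfield L)) L (IsCMField.complexConj L) 2 (Matrix.diagonal dV))) [ν.IsHaarMeasure] :
    ∃ C : ℝ, 0 ≤ C ∧ ∀ R : ℝ, 1 ≤ R →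
      ν {b | (GLn.archHeight 2 L (GLn.ofInfinite 2 L (b : GL (Fin 2) (mixedSpace L))) : ℝ) ≤ R} ≤ ENNReal.ofReal (C * R ^ 2) := by
  classical
  -- topological instances
  haveI : ∀ w : {w : InfinitePlace L // w.IsComplex}, SecondCountableTopology ↥(archLocal L 2 (Matrix.diagonal dV) w) :=
    fun w => secondCountableTopology_archLocal L 2 _ w
  haveI : ∀ w : {w : InfinitePlace L // w.IsComplex}, LocallyCompactSpace ↥(archLocal L 2 (Matrix.diagonal dV) w) :=
    fun w => locallyCompactSpace_archLocal L 2 _ w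
  haveI := locallyCompactSpace_mixedSpaceGL L 2
  haveI := secondCountableTopology_mixedSpaceGL L 2
  haveI : LocallyCompactSpace ↥(arch (↥(maximalRealSubfield L)) L (IsCMField.complexConj L) 2 (Matrix.diagonal dV)) :=
    (UnitaryGroup.isClosed_arch (↥(maximalRealSubfield L)) L (IsCMField.complexConj L) 2 _).isClosedEmbedding_subtypeVal.locallyCompactSpace
  haveI : SecondCountableTopology ↥(arch (↥(maximalRealSubfield L)) L (IsCMField.complexConj L) 2 (Matrix.diagonal dV)) :=
    Topology.IsEmbedding.subtypeVal.secondCountableTopology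
  -- Borel structures and Haar measures on the factors; the model Haar measure on `G_∞`
  letI : ∀ w : {w : InfinitePlace L // w.IsComplex}, MeasurableSpace ↥(archLocal L 2 (Matrix.diagonal dV) w) := fun w => borel _
  haveI : ∀ w : {w : InfinitePlace L // w.IsComplex}, BorelSpace ↥(archLocal L 2 (Matrix.diagonal dV) w) := fun w => ⟨rfl⟩
  set νw : ∀ w : {w : InfinitePlace L // w.IsComplex}, Measure ↥(archLocal L 2 (Matrix.diagonal dV) w) := fun w => Measure.haar with hνw
  set μT : Measure (∀ w : {w : InfinitePlace L // w.IsComplex}, ↥(archLocal L 2 (Matrix.diagonal dV) w)) := Measure.pi νw with hμT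
  haveI : μT.IsHaarMeasure := by rw [hμT]; infer_instance
  set e := archPiEquivCM 2 L (Matrix.diagonal dV) with he
  set μH : Measure ↥(arch (↥(maximalRealSubfield L)) L (IsCMField.complexConj L) 2 (Matrix.diagonal dV)) := Measure.map e.symm μT with hμH
  haveI : μH.IsHaarMeasure := by rw [hμH]; infer_instance
  have hν : ν = haarScalarFactor ν μH • μH := isMulLeftInvariant_eq_smul ν μH
  -- the distinguished place `w₀ = w_ι` (§3) and the compact places `w ≠ w₀`
  set w₀ : {w : InfinitePlace L // w.IsComplex} := ⟨InfinitePlace.mk ι, IsTotallyComplex.isComplex _⟩ with hw₀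
  obtain ⟨C₀, hC₀0, hC₀⟩ := haar_archLocal_entryBox_le L dV hdV hdV0 w₀ (νw w₀)
  have hcpt : ∀ w : {w : InfinitePlace L // w.IsComplex}, w ≠ w₀ → νw w Set.univ ≠ ⊤ := fun w hw => by
    have hne : InfinitePlace.mk w.1.embedding ≠ InfinitePlace.mk ι := by
      rw [InfinitePlace.mk_embedding]
      exact fun h => hw (Subtype.ext h)
    haveI : CompactSpace ↥(archLocal L 2 (Matrix.diagonal dV) w) :=
      isCompact_iff_compactSpace.1 (isCompact_archLocal_of_posDef L 2 (Matrix.diagonal dV) w (Or.inl (hpos _ hne)))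
    exact measure_ne_top _ _
  set P : ℝ≥0∞ := ∏ w ∈ Finset.univ.erase w₀, νw w Set.univ with hP
  have hPfin : P ≠ ⊤ := ENNReal.prod_ne_top fun w hw => hcpt w (Finset.ne_of_mem_erase hw)
  refine ⟨(haarScalarFactor ν μH : ℝ) * C₀ * P.toReal, mul_nonneg (mul_nonneg (NNReal.coe_nonneg _) hC₀0) ENNReal.toReal_nonneg, fun R hR => ?_⟩
  -- the height ball and its model: a product of entry boxes
  set S : Set ↥(arch (↥(maximalRealSubfield L)) L (IsCMField.complexConj L) 2 (Matrix.diagonal dV)) :=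
    {b | (GLn.archHeight 2 L (GLn.ofInfinite 2 L (b : GL (Fin 2) (mixedSpace L))) : ℝ) ≤ R} with hS
  set E : ∀ w : {w : InfinitePlace L // w.IsComplex}, Set ↥(archLocal L 2 (Matrix.diagonal dV) w) :=
    fun w => {y | ∀ i j, ‖((y : GL (Fin 2) ℂ) : Matrix (Fin 2) (Fin 2) ℂ) i j‖ ≤ R} with hE
  have hpre : e.symm ⁻¹' S ⊆ Set.pi Set.univ E := by
    intro y hy
    rw [Set.mem_preimage, hS, Set.mem_setOf_eq] at hy
    refine Set.mem_univ_pi.2 fun w i j => ?_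
    have h1 : (((y w : ↥(archLocal L 2 (Matrix.diagonal dV) w)) : GL (Fin 2) ℂ) : Matrix (Fin 2) (Fin 2) ℂ) i j =
        ((((e.symm y : ↥(arch (↥(maximalRealSubfield L)) L (IsCMField.complexConj L) 2 (Matrix.diagonal dV))) :
          GL (Fin 2) (mixedSpace L)) : Matrix (Fin 2) (Fin 2) (mixedSpace L)) i j).2 w := by
      have h2 := coe_archPiEquivCM_apply L 2 (Matrix.diagonal dV) (e.symm y) w
      rw [he, ContinuousMulEquiv.apply_symm_apply] at h2
      rw [← he] at h2
      rw [h2]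
      rfl
    rw [h1]
    calc ‖((((e.symm y : ↥(arch (↥(maximalRealSubfield L)) L (IsCMField.complexConj L) 2 (Matrix.diagonal dV))) :
          GL (Fin 2) (mixedSpace L)) : Matrix (Fin 2) (Fin 2) (mixedSpace L)) i j).2 w‖
        ≤ ‖(((e.symm y : ↥(arch (↥(maximalRealSubfield L)) L (IsCMField.complexConj L) 2 (Matrix.diagonal dV))) :
          GL (Fin 2) (mixedSpace L)) : Matrix (Fin 2) (Fin 2) (mixedSpace L)) i j‖ := (norm_le_pi_norm _ w).trans (norm_snd_le _)
      _ ≤ (GLn.archHeight 2 L (GLn.ofInfinite 2 L ((e.symm y : ↥(arch (↥(maximalRealSubfield L)) L (IsCMField.complexConj L) 2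
          (Matrix.diagonal dV))) : GL (Fin 2) (mixedSpace L))) : ℝ) := norm_apply_le_archHeight_ofInfinite _ i j
      _ ≤ R := hy
  have hmap : μH S = μT (e.symm ⁻¹' S) := by
    rw [hμH, show (⇑e.symm : _ → _) = ⇑e.symm.toHomeomorph.toMeasurableEquiv from rfl, MeasurableEquiv.map_apply]
  have hpi : μT (Set.pi Set.univ E) = ∏ w, νw w (E w) := by rw [hμT, Measure.pi_pi]
  -- place by place
  have hle : ∀ w, νw w (E w) ≤ (if w = w₀ then ENNReal.ofReal (C₀ * R ^ 2) else νw w Set.univ) := by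
    intro w
    by_cases hw : w = w₀
    · subst hw
      rw [if_pos rfl]
      exact hC₀ R hR
    · rw [if_neg hw]
      exact measure_mono (Set.subset_univ _)
  have hprod : ∏ w, (if w = w₀ then ENNReal.ofReal (C₀ * R ^ 2) else νw w Set.univ) = ENNReal.ofReal (C₀ * R ^ 2) * P := by
    rw [← Finset.mul_prod_erase Finset.univ _ (Finset.mem_univ w₀), if_pos rfl, hP]
    congr 1
    exact Finset.prod_congr rfl fun w hw => if_neg (Finset.ne_of_mem_erase hw)
  have hc : ((haarScalarFactor ν μH : ℝ≥0) : ℝ≥0∞) = ENNReal.ofReal (haarScalarFactor ν μH : ℝ) := ENNReal.ofReal_coe_nnreal.symm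
  have hPr : P = ENNReal.ofReal P.toReal := (ENNReal.ofReal_toReal hPfin).symm
  have hR2 : 0 ≤ C₀ * R ^ 2 := mul_nonneg hC₀0 (sq_nonneg R)
  calc ν S = (haarScalarFactor ν μH • μH) S := by rw [← hν]
    _ = haarScalarFactor ν μH * μH S := by rw [Measure.coe_nnreal_smul_apply]
    _ = haarScalarFactor ν μH * μT (e.symm ⁻¹' S) := by rw [hmap]
    _ ≤ haarScalarFactor ν μH * μT (Set.pi Set.univ E) := by gcongr
    _ = haarScalarFactor ν μH * ∏ w, νw w (E w) := by rw [hpi]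
    _ ≤ haarScalarFactor ν μH * ∏ w, (if w = w₀ then ENNReal.ofReal (C₀ * R ^ 2) else νw w Set.univ) := by
        gcongr with w _
        exact hle w
    _ = haarScalarFactor ν μH * (ENNReal.ofReal (C₀ * R ^ 2) * P) := by rw [hprod]
    _ = ENNReal.ofReal ((haarScalarFactor ν μH : ℝ) * C₀ * P.toReal * R ^ 2) := by
        rw [hc, hPr, ENNReal.toReal_ofReal ENNReal.toReal_nonneg, ← ENNReal.ofReal_mul hR2, ← ENNReal.ofReal_mul (NNReal.coe_nonneg _)]
        congr 1
        ring

end Arch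

end Summit.HodgeConjecture.HodgeConjecture.Cruxes.HLiu418.K2LiuArchHeightBallRankOne

end
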